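import Mathlib
import Literature.MathematicalPhysics.QuantumFieldTheory.Balaban1983to89.B16Ineq147Count261
import Literature.MathematicalPhysics.QuantumFieldTheory.Balaban1983to89.B15LatticeCubeTorus

/-!
# `Balaban1983to89.B16Ineq147LatticeContours` — [Balaban1989LargeFieldII] (1.47) p. 368 BY NAME on the LATTICE-CONTOUR
# reading (R0, print-literal) of [Balaban1984PropagatorsII] (2.46), on the ℤᵈ cover AND ON THE TORUS T_η, with the d-ONLY
# row-sum constants c₁″ — and the (2.61″) `RowSum` letters at any rate that feed it (abstract carriers)

statement-level skeleton of published theorems with citation tags; proofs where landed; nothing here is a claim about the Yang–Mills mass gap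

CITATION HEADER (lean-in-tree rule 2026-08-18).  Sources: T. Bałaban, *Large field renormalization. II. Localization,
exponentiation, and bounds for the 𝐑 operation*, Commun. Math. Phys. **122** (1989) 355–392 [Balaban1989LargeFieldII] ((1.47)
p. 368, as typed by r13 in `B16Sect1Statements.Ineq147` and knitted by p29 in `B16Ineq147Count261`); T. Bałaban, *Propagators and
renormalization transformations for lattice gauge theories. II*, Commun. Math. Phys. **96** (1984) 223–250 [Balaban1984PropagatorsII]
(Lemma 2.1 (2.61) p. 234, (2.59) p. 233, (2.46) p. 231, (2.1)–(2.4) p. 224); *… I*, Commun. Math. Phys. **95** (1984) 17–40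
[Balaban1984PropagatorsI] (Sect. A p. 17: the torus); T. Bałaban, *The variational problem and background fields …*, Commun. Math.
Phys. **102** (1985) 277–309 [Balaban1985Variational] (Prop. 9 (190) pp. 308–309, as typed in `B11SectG`); T. Bałaban, *Large
field renormalization. I*, Commun. Math. Phys. **122** (1989) 175–202 [Balaban1989LargeFieldI] ((1.12)–(1.13) p. 179, p. 186).
WHAT IS REPRODUCED: lit-balaban SKELETON rows **B16.Eq1.47** (owner r13; cells), **B6.Lem2.1**/(2.61) (owner r03; cells),
**B15.Eq1.47** (owner r12; cells) — heads unchanged.  Mega-formalization `lit-balaban`, HOME `run/shared/lean/pub/lit-balaban/`;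
Phase-2 proof seat p29 gen 13 (unit `lit-balaban-p29`), free-target protocol G.5-34(d); companion of this seat's
`B15LatticeCubeTorus` (p321735).  KNITTING — used BY NAME, nothing restated: p29 `B16Ineq147Count261.ineq147_of_ineq190_levelGap`
(p315167; r13's `B16Ineq147Chain`/`B16Sect1Statements.Ineq147` behind it), `B15LatticeCubeContours.{latC, latSystem, latC_connected,
levelGap_latC, ineq261T_latC, sum_exp_le_latC}` (p319887), `B15LatticeCubeTorus.{IsPeriodic, TSite, torC, zoneT, shift,
exists_lift_dist_eq, eq_of_shift_eq, torC_connected, levelGap_torC}` (p321735), `B11SectG.RowSum`, `B6Lemma21Repaired.Ineq261With`,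
`B6Lemma21TwoScale.{c1TwoScale, Lemma21TwoScale, lemma21TwoScale_of_ineq261T}`, `B6Geometry.ContourSystem`, `B6.Cond259`.

THE PRINTED TEXT.  [LF-II] (1.47) p. 368 (verbatim = docstring of `B16Sect1Statements.Ineq147`; the implicit count «Σ_j Σ_{x∈Γ″_j}
exp(−½δd(x, Ω″^{~2}_{h+1})) … ≦ O(1)|Γ″_h ∩ Ω″^{~2}_{h+1}|»).  [B6] p. 231: *«a part of Γ contained in B^j(Λ_j) consists of bonds of
the lattice Λ_j … d(y, y′) = inf_Γ Σ_j (L^jη)^{−1}|Γ_{y,y′} ∩ B^j(Λ_j)| (2.46)»*; p. 234 (2.61); p. 224 *«Ω_j ⊂ T_η»*.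

WHAT THIS FILE PROVES (kernel-checked, zero `sorry`; one reducible `ContourSystem` constructor `torSystemOf`; theorems otherwise;
no named fact; axioms standard).
§1 `rowSum_of_ineq261With` (the display (2.61) at `(α, δ₀)` IS the letter `RowSum g (αδ₀) c`), **`rowSum_latC`** — (2.61″) AT ANY
   RATE `r > 0` on the cover with the d-only constant `c1TwoScale d (2r) ½ = 13c₀(2r, ¼)^{4d}` under `Cond259 d (2r) ½ R M`.
§2 `torSystemOf`, **`ineq261T_torC`** — (2.61″) ON THE TORUS for EVERY geometry realised by the torus contours (abstract carrier
   `g`, `ι : g.Site ↪ TSite`; the abstract form of `B15LatticeCubeTorus.ineq261T_torGeo`, same transfer: optimal lifts of the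
   row, orbit-injectivity, `sum_exp_le_latC` on `{g with dist := cover distance of the lifts}`), `rowSum_torC`,
   **`lemma21TwoScale_torC`** (Lemma 2.1, two-scale constant, uniformly over any family of such geometries).
§3 **`ineq147_of_ineq190_latC`**, **`ineq147_of_ineq190_torC`** — (1.47) p. 368 BY NAME with `Realizes`/`Connected`/`LevelGap`
   AND BOTH ROW SUMS (rates `σ`, `½δ`) DISCHARGED on the lattice-contour reading, cover and torus, constants `c1TwoScale d (2σ) ½`
   and `c1TwoScale d δ ½` (d-only) under the two (2.59) conditions; carried verbatim: (190), `hmv`, source size/support + zone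
   data, multiplicity, J-side letters, `hne`, r13's arithmetic dictionary (`M ≤ M_Z/M₁`), the box count `|S| ≦ C_γM⁴R_k⁵`.
HONEST SCOPE.  (i) The two (2.59) conditions (`2d·log c₀(2r, ¼) + 1 < ¼·½·2r·RM`) are print's «RM sufficiently large» at the
two rates; no attempt is made to optimise them.  (ii) Reading R0 and the corrected d-only constant as in `B15LatticeCubeContours` /
`B15LatticeCubeTorus` (their honest scopes apply; the printed c₁(α) stays refuted as typed).  (iii) The (1.47) knits inherit the
declared reading of `B16Ineq147Count261` (print's `d(x, Ω″^{~2}_{h+1})` = distance to the blocks carrying the argument).  (iv)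
Bookkeeping of a published proof; NOT progress on any Clay problem.
-/

namespace Literature.MathematicalPhysics.QuantumFieldTheory.Balaban1983to89.B16Ineq147LatticeContours

open Literature.MathematicalPhysics.QuantumFieldTheory.Balaban1983to89
open B11SectG B16Ineq147Count261 B16Ineq147FirstFrom190 B6Geometry B15Ineq147LevelGap B15TouchingCubeContours
  B15LatticeCubeContours B15LatticeCubeTorus Finset

noncomputable section

variable {g : B6.Geometry} {α : Type*}

/-! ## §1 (2.61″) of the lattice-contour readings as `RowSum` letters at any rate, d-only constants -/

/-- The generic-constant display (2.61) at `(α, δ₀)` IS the row-sum letter `RowSum g (αδ₀) c` of the (190)-knits.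
[cite: Balaban1984PropagatorsII, (2.61) p.234] -/
theorem rowSum_of_ineq261With {c δ₀ a σ : ℝ} (hσ : a * δ₀ = σ) (h : B6Lemma21Repaired.Ineq261With c g δ₀ a) :
    RowSum g σ c := by
  subst hσ
  exact h

section Cover

variable {d M₁ L MZ : ℕ} {Z : ℕ → Set (Fin d → ℤ)} [NeZero d]

/-- **(2.61″) AT ANY RATE `r > 0` ON THE COVER, d-ONLY CONSTANT**: for a geometry realised by the lattice contours `latC` of a
nested cube model (embedding `ι` with zones, `g.dist` = the lattice-contour distance, `Monotone Z″`, one separating layer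
`LayerSepZd Z″ M_Z L`, the covering `Tiles`, `1 ≤ M₁ ≤ M_Z`, `L ≥ 2`, `R·M ≤ M_Z/M₁`, `2 ≤ M_Z/M₁`) and the (2.59) condition at
`(δ₀, α) = (2r, ½)`: `RowSum g r (c₁″)` with `c₁″ = c1TwoScale d (2r) ½ = 13c₀(2r, ¼)^{4d}` — `B15LatticeCubeContours.ineq261T_latC`.
[cite: Balaban1984PropagatorsII, Lemma 2.1 (2.61) p.234, (2.59) p.233; Balaban1989LargeFieldI, p.179, p.186; corrected] -/
theorem rowSum_latC (ι : g.Site → CubeSite M₁ L Z) (hι : Function.Injective ι) (hzone : ∀ y, zoneC (ι y) = g.scale y)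
    (hdistG : ∀ y y', g.dist y y' = ((latC M₁ L Z).dist (ι y) (ι y') : ℝ)) (hmono : Monotone Z) (hsep : LayerSepZd Z MZ L)
    (ht : Tiles M₁ L Z) (hM₁ : 0 < M₁) (hM : M₁ ≤ MZ) (hL : 2 ≤ L) (hRM : g.R * g.M ≤ ((MZ / M₁ : ℕ) : ℝ)) (hN : 2 ≤ MZ / M₁)
    {r : ℝ} (hr : 0 < r) (h259 : B6.Cond259 d (2 * r) (1 / 2) g.R g.M) :
    RowSum g r (B6Lemma21TwoScale.c1TwoScale d (2 * r) (1 / 2)) :=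
  rowSum_of_ineq261With (by ring)
    (ineq261T_latC ι hι hzone hdistG hmono hsep ht hM₁ hM hL hRM hN (by norm_num) (by linarith) h259)

end Cover

/-! ## §2 (2.61″) ON THE TORUS for any geometry realised by the torus contours (abstract `g`, embedding into `TSite`) -/

section Torus

variable {d M₁ L MZ : ℕ} {Z : ℕ → Set (Fin d → ℤ)} {P : Fin d → ℕ} [NeZero d]

/-- The torus contour system of a geometry whose generating set is embedded in the torus cube-sites (zones = scales).
[cite: Balaban1984PropagatorsII, (2.45)–(2.46) p.231; Balaban1984PropagatorsI, Sect. A p.17] -/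
@[reducible] def torSystemOf (h : IsPeriodic M₁ L Z P) (ι : g.Site → TSite M₁ L Z P)
    (hzone : ∀ y, zoneT (ι y) = g.scale y) : ContourSystem g :=
  ⟨TSite M₁ L Z P, torC h, ι, zoneT, hzone⟩

/-- **(2.61″) ON THE TORUS FOR EVERY GEOMETRY REALISED BY THE TORUS CONTOURS** (abstract `g`, `ι : g.Site ↪ TSite` with zones,
`g.dist` = the torus contour distance): `Ineq261With (c1TwoScale d δ₀ α) g δ₀ α` under (2.59) — the abstract-carrier form of
`B15LatticeCubeTorus.ineq261T_torGeo`, by the same TRANSFER (optimal lifts of the row, orbit-injectivity, the cover's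
`sum_exp_le_latC` on the geometry `{g with dist := cover distance of the lifts}`). [cite: Balaban1984PropagatorsII, Lemma 2.1 (2.61) p.234, (2.46) p.231; Balaban1984PropagatorsI, Sect. A p.17; Balaban1989LargeFieldI, p.179; corrected] -/
theorem ineq261T_torC (h : IsPeriodic M₁ L Z P) (ι : g.Site → TSite M₁ L Z P) (hι : Function.Injective ι)
    (hzone : ∀ y, zoneT (ι y) = g.scale y) (hdistG : ∀ y y', g.dist y y' = ((torC h).dist (ι y) (ι y') : ℝ))
    (hmono : Monotone Z) (hsep : LayerSepZd Z MZ L) (ht : Tiles M₁ L Z) (hM₁ : 0 < M₁) (hM : M₁ ≤ MZ) (hL : 2 ≤ L)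
    (hRM : g.R * g.M ≤ ((MZ / M₁ : ℕ) : ℝ)) (hN : 2 ≤ MZ / M₁) {δ₀ a : ℝ} (ha : 0 < a) (hδ : 0 < δ₀)
    (h259 : B6.Cond259 d δ₀ a g.R g.M) :
    B6Lemma21Repaired.Ineq261With (B6Lemma21TwoScale.c1TwoScale d δ₀ a) g δ₀ a := by
  intro y
  have hconn := latC_connected hmono hsep ht hM₁ hM hL
  choose v hv using fun b : g.Site => exists_lift_dist_eq (h := h) hconn (ι y) (ι b)
  set ι' : g.Site → CubeSite M₁ L Z := fun b => shift h (v b) (ι b).1 with hι'def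
  have hιy : ι' y = (ι y).1 := by
    have h0 : (latC M₁ L Z).dist (ι y).1 (ι' y) = 0 := by
      rw [hι'def]
      simp only
      rw [hv y, SimpleGraph.dist_self]
    exact ((hconn.dist_eq_zero_iff).mp h0).symm
  have hι' : Function.Injective ι' := fun b c hbc => hι (eq_of_shift_eq (h := h) hmono hM₁ (by omega) hbc)
  have hrow := sum_exp_le_latC (g := { g with dist := fun a b => ((latC M₁ L Z).dist (ι' a) (ι' b) : ℝ) }) ι' hι'
    (fun b => by rw [← hzone b]; rfl) (fun _ _ => rfl) hmono hsep ht hM₁ hM hL hRM hN ha hδ h259 y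
  calc ∑ y' : g.Site, Real.exp (-(a * δ₀ * g.dist y y'))
      = ∑ y' : g.Site, Real.exp (-(a * δ₀ * (((latC M₁ L Z).dist (ι' y) (ι' y') : ℕ) : ℝ))) := by
        refine Finset.sum_congr rfl fun y' _ => ?_
        rw [hdistG, hιy, hι'def]
        simp only
        rw [hv y']
    _ ≤ 13 * B6.c0 δ₀ (a / 2) ^ (4 * d) := hrow

/-- **(2.61″) AT ANY RATE `r > 0` ON THE TORUS, d-ONLY CONSTANT** — `RowSum g r (c1TwoScale d (2r) ½)` under (2.59) at
`(2r, ½)`, for geometries realised by the torus contours. [cite: Balaban1984PropagatorsII, Lemma 2.1 (2.61) p.234; Balaban1984PropagatorsI, Sect. A p.17; corrected] -/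
theorem rowSum_torC (h : IsPeriodic M₁ L Z P) (ι : g.Site → TSite M₁ L Z P) (hι : Function.Injective ι)
    (hzone : ∀ y, zoneT (ι y) = g.scale y) (hdistG : ∀ y y', g.dist y y' = ((torC h).dist (ι y) (ι y') : ℝ))
    (hmono : Monotone Z) (hsep : LayerSepZd Z MZ L) (ht : Tiles M₁ L Z) (hM₁ : 0 < M₁) (hM : M₁ ≤ MZ) (hL : 2 ≤ L)
    (hRM : g.R * g.M ≤ ((MZ / M₁ : ℕ) : ℝ)) (hN : 2 ≤ MZ / M₁) {r : ℝ} (hr : 0 < r)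
    (h259 : B6.Cond259 d (2 * r) (1 / 2) g.R g.M) :
    RowSum g r (B6Lemma21TwoScale.c1TwoScale d (2 * r) (1 / 2)) :=
  rowSum_of_ineq261With (by ring)
    (ineq261T_torC h ι hι hzone hdistG hmono hsep ht hM₁ hM hL hRM hN (by norm_num) (by linarith) h259)

/-- **LEMMA 2.1 (TWO-SCALE CONSTANT) FOR EVERY FAMILY OF GEOMETRIES REALISED BY TORUS CONTOURS** (abstract carriers): the
family form of `ineq261T_torC` through `B6Lemma21TwoScale.lemma21TwoScale_of_ineq261T`. [cite: Balaban1984PropagatorsII, Lemma 2.1 (2.60)–(2.61) p.234; Balaban1984PropagatorsI, Sect. A p.17; corrected] -/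
theorem lemma21TwoScale_torC {I : Type} {δ₀ : ℝ} (hδ : 0 < δ₀) (geo : I → B6.Geometry) (M₁ L MZ : I → ℕ)
    (Z : I → ℕ → Set (Fin d → ℤ)) (P : I → Fin d → ℕ) (h : ∀ i, IsPeriodic (M₁ i) (L i) (Z i) (P i))
    (ι : ∀ i, (geo i).Site → TSite (M₁ i) (L i) (Z i) (P i)) (hι : ∀ i, Function.Injective (ι i))
    (hzone : ∀ i y, zoneT (ι i y) = (geo i).scale y)
    (hdistG : ∀ i y y', (geo i).dist y y' = ((torC (h i)).dist (ι i y) (ι i y') : ℝ))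
    (hmono : ∀ i, Monotone (Z i)) (hsep : ∀ i, LayerSepZd (Z i) (MZ i) (L i)) (ht : ∀ i, Tiles (M₁ i) (L i) (Z i))
    (hM₁ : ∀ i, 0 < M₁ i) (hM : ∀ i, M₁ i ≤ MZ i) (hL : ∀ i, 2 ≤ L i)
    (hRM : ∀ i, (geo i).R * (geo i).M ≤ ((MZ i / M₁ i : ℕ) : ℝ)) (hN : ∀ i, 2 ≤ MZ i / M₁ i) :
    B6Lemma21TwoScale.Lemma21TwoScale d δ₀ geo :=
  B6Lemma21TwoScale.lemma21TwoScale_of_ineq261T d δ₀ hδ.le geo (fun i => torSystemOf (h i) (ι i) (hzone i))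
    (fun i => MZ i / M₁ i) (fun i => hdistG i)
    (fun i => torC_connected (latC_connected (hmono i) (hsep i) (ht i) (hM₁ i) (hM i) (hL i)))
    (fun i => levelGap_torC (levelGap_latC (hmono i) (hsep i) (hM₁ i) (hL i))) hRM
    fun i _ _ ha _ h259 => ineq261T_torC (h i) (ι i) (hι i) (hzone i) (hdistG i) (hmono i) (hsep i) (ht i) (hM₁ i) (hM i)
      (hL i) (hRM i) (hN i) ha hδ h259

end Torus

/-! ## §3 (1.47) p. 368 [LF-II] BY NAME on the LATTICE contours (reading R0) with d-ONLY constants — cover and torus -/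

section Knit

variable [DecidableEq g.Site] {FB FA : Type} [AddCommGroup FB] [Module ℝ FB] [AddCommGroup FA] [Module ℝ FA]
  {d M₁ L MZ : ℕ} {Z : ℕ → Set (Fin d → ℤ)} {P : Fin d → ℕ} [NeZero d]

/-- **(1.47) p. 368 BY NAME FOR EVERY GEOMETRY REALISED BY THE LATTICE CONTOURS OF A NESTED CUBE MODEL (reading R0, the
cover ℤᵈ), WITH d-ONLY CONSTANTS** — `B16Ineq147Count261.ineq147_of_ineq190_levelGap` (count from (2.61), dictionary of the
distance, separation from the level gaps) with `Realizes`/`Connected`/`LevelGap (M_Z/M₁)` DISCHARGED by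
`B15LatticeCubeContours.{latSystem, latC_connected, levelGap_latC}` and BOTH ROW SUMS — at the knitting rate `σ` and at `½δ` —
DISCHARGED by `rowSum_latC` with the constants `c1TwoScale d (2σ) ½`, `c1TwoScale d δ ½` (13c₀(·,¼)^{4d}: independent of L, of
the volume and of the number of scales) under the two (2.59) conditions `Cond259 d (2σ) ½ R M`, `Cond259 d δ ½ R M`
(`R·M ≤ M_Z/M₁`).  Carried verbatim: (190), `hmv`, the source size/support with its zone data, the multiplicity, the J-side
letters, `hne`, r13's arithmetic inputs (`M ≤ M_Z/M₁` for the separation), the box count; the printed shape of `Z″`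
(`Monotone`, `LayerSepZd`, `Tiles`), `1 ≤ M₁ ≤ M_Z`, `L ≥ 2`, `2 ≤ M_Z/M₁`, `σ, δ > 0`.  Compare §7 of `B16Ineq147Count261`
(touching cubes, L-dependent `K261`). [cite: Balaban1989LargeFieldII, (1.47) p.368; Balaban1985Variational, Prop. 9 (190) pp.308–309; Balaban1984PropagatorsII, Lemma 2.1 (2.61) p.234, (2.59) p.233, (2.46) p.231, (2.2)–(2.4) p.224; Balaban1989LargeFieldI, (1.12)–(1.13) p.179, p.186; corrected] -/
theorem ineq147_of_ineq190_latC {T : Type*} {bB : BlockNorm g FB} {bout : BlockNorm g FA} {dH : T → FB →ₗ[ℝ] FA}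
    {Cc δ₀ σ τ B₃ δ C₀ Linv B₅ M alpha gk C' εk β₀ C₁ q₁g A₀ p₀g Rk Cγ : ℝ} {N k h : ℕ} {ε : ℕ → ℝ}
    {Γ : ℕ → Finset α} {dist : α → ℝ}
    (ι : g.Site → CubeSite M₁ L Z) (hι : Function.Injective ι) (hzone : ∀ y, zoneC (ι y) = g.scale y)
    (hdistG : ∀ y y', g.dist y y' = ((latC M₁ L Z).dist (ι y) (ι y') : ℝ))
    (hmono : Monotone Z) (hsep : LayerSepZd Z MZ L) (htile : Tiles M₁ L Z) (hM₁ : 0 < M₁) (hMZ : M₁ ≤ MZ) (hL : 2 ≤ L)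
    (hRM : g.R * g.M ≤ ((MZ / M₁ : ℕ) : ℝ)) (hN2 : 2 ≤ MZ / M₁) (hσ : 0 < σ)
    (h259σ : B6.Cond259 d (2 * σ) (1 / 2) g.R g.M) (h259δ : B6.Cond259 d δ (1 / 2) g.R g.M)
    (h190 : ∀ t, Ineq190 bB bout (dH t) Cc δ₀) (hCc : 0 ≤ Cc)
    (hτ : 0 ≤ τ) (hστ : σ + τ ≤ δ₀ / 8) (hδτ : δ ≤ τ) (B : FB) {HB : FA}
    (hmv : ∀ (y : g.Site) (s : ℝ), (∀ t, bout.loc y (dH t B) ≤ s) → bout.loc y HB ≤ s)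
    (hm : ∀ y', bB.loc y' B < C₀ * Linv ^ N * B₃ ^ 2 * B₅ * M ^ 6 * alpha)
    {S : Finset g.Site} (hSupp : ∀ y', bB.loc y' B ≠ 0 → y' ∈ S) (hzoneS : ∀ y' ∈ S, h + 1 ≤ g.scale y')
    (hCB : Cc * bB.κ * B6Lemma21TwoScale.c1TwoScale d (2 * σ) (1 / 2) ≤ B₃) (hB₃ : 0 < B₃)
    {yOf : ℕ → α → g.Site} {nf : α → ℝ} {nJ s : ℕ → α → ℝ} {m : ℕ}
    (hzoneΓ : ∀ j ∈ Icc 1 h, ∀ x ∈ Γ j, g.scale (yOf j x) ≤ j)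
    (hmult : ∀ j ∈ Icc 1 h, ∀ y : g.Site, #{x ∈ Γ j | yOf j x = y} ≤ m)
    (hdistS : ∀ j ∈ Icc 1 h, ∀ x ∈ Γ j, ∀ y' ∈ S, dist x ≤ g.dist (yOf j x) y')
    (hdistS' : ∀ j ∈ Icc 1 h, ∀ x ∈ Γ j, ∃ y' ∈ S, g.dist (yOf j x) y' ≤ dist x)
    (hdom : ∀ j ∈ Icc 1 h, ∀ x ∈ Γ j, nf x ≤ bout.loc (yOf j x) HB)
    (hJ : ∀ j ∈ Icc 1 h, ∀ x ∈ Γ j, nJ j x ≤ ((gk ^ 2)⁻¹ + C' * ((k : ℝ) - j)) * ε j)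
    (hJnn : ∀ j ∈ Icc 1 h, ∀ x ∈ Γ j, 0 ≤ nJ j x)
    (hJpos : ∀ j ∈ Icc 1 h, (Γ j).Nonempty → 0 < ((gk ^ 2)⁻¹ + C' * ((k : ℝ) - j)) * ε j)
    (hpair : ∀ j ∈ Icc 1 h, ∀ x ∈ Γ j, |s j x| ≤ nf x * nJ j x)
    (hne : ∃ j ∈ Icc 1 h, (Γ j).Nonempty) {Tval : ℝ} (hT : Tval = ∑ j ∈ Icc 1 h, ∑ x ∈ Γ j, s j x)
    (hC : 0 ≤ C₀) (hLinv : 0 ≤ Linv) (hB₅ : 0 ≤ B₅) (hα : 0 ≤ alpha)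
    (hgk : 0 < gk) (hgk1 : gk ≤ 1) (hC' : 0 ≤ C') (hεk : 0 ≤ εk) (hδ : 0 < δ) (hβ₀ : 0 ≤ β₀)
    (hβ₁ : β₀ ≤ 1) (hN : 1 ≤ N) (hk : k = h + N) (hδM : 6 ≤ δ * M) (hMN : M ≤ ((MZ / M₁ : ℕ) : ℝ))
    (hε : ∀ j ∈ Icc 1 h, ε j ≤ (1 + β₀) ^ 2 * ((k : ℝ) - j) ^ β₀ * εk)
    (hαeq : alpha = C₁ * gk * q₁g) (hεeq : εk = gk * A₀ * p₀g) (hNW : B16Sect1Kernels.NWindowUpper N Rk)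
    (hΓ : (#S : ℝ) ≤ Cγ * M ^ 4 * Rk ^ 5) :
    B16Sect1Statements.Ineq147 Tval
      ((C₀ * (1 + C') * (1 + β₀) ^ 2 * (2 * (m * B6Lemma21TwoScale.c1TwoScale d δ (1 / 2)))) * Cγ) A₀ C₁ B₃ B₅ M p₀g
      q₁g Rk Linv N :=
  ineq147_of_ineq190_levelGap (C := latSystem ι hzone) (fun y y' => hdistG y y')
    (latC_connected hmono hsep htile hM₁ hMZ hL) (levelGap_latC hmono hsep hM₁ hL) h190 hCc
    (hrow := rowSum_latC ι hι hzone hdistG hmono hsep htile hM₁ hMZ hL hRM hN2 hσ h259σ) (hrow₂ := rowSum_of_ineq261With (by ring)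
      (ineq261T_latC ι hι hzone hdistG hmono hsep htile hM₁ hMZ hL hRM hN2 (by norm_num) hδ h259δ)) hτ hστ hδτ B hmv hm hSupp hzoneS hCB hB₃ hzoneΓ hmult hdistS hdistS' hdom hJ hJnn hJpos
    hpair hne hT hC hLinv hB₅ hα hgk hgk1 hC' hεk hδ.le hβ₀ hβ₁ hN hk hδM hMN hε hαeq hεeq hNW hΓ

/-- **(1.47) p. 368 BY NAME ON THE TORUS `T_η` — PRINT'S SETTING — FOR EVERY GEOMETRY REALISED BY THE TORUS LATTICE CONTOURS
(reading R0, wrap-around), WITH d-ONLY CONSTANTS**: as `ineq147_of_ineq190_latC` with the cover replaced by the torus of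
`B15LatticeCubeTorus` (`IsPeriodic`, embedding into `TSite`, `g.dist` = the `torC` distance): `Realizes`/`Connected`/`LevelGap`
by `torSystemOf`/`torC_connected`/`levelGap_torC`, both row sums by `rowSum_torC`/`ineq261T_torC` (the transfer).
[cite: Balaban1989LargeFieldII, (1.47) p.368; Balaban1985Variational, Prop. 9 (190) pp.308–309; Balaban1984PropagatorsII, Lemma 2.1 (2.61) p.234, (2.59) p.233, (2.46) p.231, (2.1)–(2.4) p.224; Balaban1984PropagatorsI, Sect. A p.17; Balaban1989LargeFieldI, (1.12)–(1.13) p.179, p.186; corrected] -/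
theorem ineq147_of_ineq190_torC {T : Type*} {bB : BlockNorm g FB} {bout : BlockNorm g FA} {dH : T → FB →ₗ[ℝ] FA}
    {Cc δ₀ σ τ B₃ δ C₀ Linv B₅ M alpha gk C' εk β₀ C₁ q₁g A₀ p₀g Rk Cγ : ℝ} {N k h : ℕ} {ε : ℕ → ℝ}
    {Γ : ℕ → Finset α} {dist : α → ℝ}
    (hP : IsPeriodic M₁ L Z P) (ι : g.Site → TSite M₁ L Z P) (hι : Function.Injective ι)
    (hzone : ∀ y, zoneT (ι y) = g.scale y) (hdistG : ∀ y y', g.dist y y' = ((torC hP).dist (ι y) (ι y') : ℝ))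
    (hmono : Monotone Z) (hsep : LayerSepZd Z MZ L) (htile : Tiles M₁ L Z) (hM₁ : 0 < M₁) (hMZ : M₁ ≤ MZ) (hL : 2 ≤ L)
    (hRM : g.R * g.M ≤ ((MZ / M₁ : ℕ) : ℝ)) (hN2 : 2 ≤ MZ / M₁) (hσ : 0 < σ)
    (h259σ : B6.Cond259 d (2 * σ) (1 / 2) g.R g.M) (h259δ : B6.Cond259 d δ (1 / 2) g.R g.M)
    (h190 : ∀ t, Ineq190 bB bout (dH t) Cc δ₀) (hCc : 0 ≤ Cc)
    (hτ : 0 ≤ τ) (hστ : σ + τ ≤ δ₀ / 8) (hδτ : δ ≤ τ) (B : FB) {HB : FA}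
    (hmv : ∀ (y : g.Site) (s : ℝ), (∀ t, bout.loc y (dH t B) ≤ s) → bout.loc y HB ≤ s)
    (hm : ∀ y', bB.loc y' B < C₀ * Linv ^ N * B₃ ^ 2 * B₅ * M ^ 6 * alpha)
    {S : Finset g.Site} (hSupp : ∀ y', bB.loc y' B ≠ 0 → y' ∈ S) (hzoneS : ∀ y' ∈ S, h + 1 ≤ g.scale y')
    (hCB : Cc * bB.κ * B6Lemma21TwoScale.c1TwoScale d (2 * σ) (1 / 2) ≤ B₃) (hB₃ : 0 < B₃)
    {yOf : ℕ → α → g.Site} {nf : α → ℝ} {nJ s : ℕ → α → ℝ} {m : ℕ}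
    (hzoneΓ : ∀ j ∈ Icc 1 h, ∀ x ∈ Γ j, g.scale (yOf j x) ≤ j)
    (hmult : ∀ j ∈ Icc 1 h, ∀ y : g.Site, #{x ∈ Γ j | yOf j x = y} ≤ m)
    (hdistS : ∀ j ∈ Icc 1 h, ∀ x ∈ Γ j, ∀ y' ∈ S, dist x ≤ g.dist (yOf j x) y')
    (hdistS' : ∀ j ∈ Icc 1 h, ∀ x ∈ Γ j, ∃ y' ∈ S, g.dist (yOf j x) y' ≤ dist x)
    (hdom : ∀ j ∈ Icc 1 h, ∀ x ∈ Γ j, nf x ≤ bout.loc (yOf j x) HB)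
    (hJ : ∀ j ∈ Icc 1 h, ∀ x ∈ Γ j, nJ j x ≤ ((gk ^ 2)⁻¹ + C' * ((k : ℝ) - j)) * ε j)
    (hJnn : ∀ j ∈ Icc 1 h, ∀ x ∈ Γ j, 0 ≤ nJ j x)
    (hJpos : ∀ j ∈ Icc 1 h, (Γ j).Nonempty → 0 < ((gk ^ 2)⁻¹ + C' * ((k : ℝ) - j)) * ε j)
    (hpair : ∀ j ∈ Icc 1 h, ∀ x ∈ Γ j, |s j x| ≤ nf x * nJ j x)
    (hne : ∃ j ∈ Icc 1 h, (Γ j).Nonempty) {Tval : ℝ} (hT : Tval = ∑ j ∈ Icc 1 h, ∑ x ∈ Γ j, s j x)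
    (hC : 0 ≤ C₀) (hLinv : 0 ≤ Linv) (hB₅ : 0 ≤ B₅) (hα : 0 ≤ alpha)
    (hgk : 0 < gk) (hgk1 : gk ≤ 1) (hC' : 0 ≤ C') (hεk : 0 ≤ εk) (hδ : 0 < δ) (hβ₀ : 0 ≤ β₀)
    (hβ₁ : β₀ ≤ 1) (hN : 1 ≤ N) (hk : k = h + N) (hδM : 6 ≤ δ * M) (hMN : M ≤ ((MZ / M₁ : ℕ) : ℝ))
    (hε : ∀ j ∈ Icc 1 h, ε j ≤ (1 + β₀) ^ 2 * ((k : ℝ) - j) ^ β₀ * εk)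
    (hαeq : alpha = C₁ * gk * q₁g) (hεeq : εk = gk * A₀ * p₀g) (hNW : B16Sect1Kernels.NWindowUpper N Rk)
    (hΓ : (#S : ℝ) ≤ Cγ * M ^ 4 * Rk ^ 5) :
    B16Sect1Statements.Ineq147 Tval
      ((C₀ * (1 + C') * (1 + β₀) ^ 2 * (2 * (m * B6Lemma21TwoScale.c1TwoScale d δ (1 / 2)))) * Cγ) A₀ C₁ B₃ B₅ M p₀g
      q₁g Rk Linv N :=
  ineq147_of_ineq190_levelGap (C := torSystemOf hP ι hzone) (fun y y' => hdistG y y')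
    (torC_connected (latC_connected hmono hsep htile hM₁ hMZ hL)) (levelGap_torC (levelGap_latC hmono hsep hM₁ hL)) h190 hCc
    (hrow := rowSum_torC hP ι hι hzone hdistG hmono hsep htile hM₁ hMZ hL hRM hN2 hσ h259σ) (hrow₂ := rowSum_of_ineq261With (by ring)
      (ineq261T_torC hP ι hι hzone hdistG hmono hsep htile hM₁ hMZ hL hRM hN2 (by norm_num) hδ h259δ)) hτ hστ hδτ B hmv hm hSupp hzoneS hCB hB₃ hzoneΓ hmult hdistS hdistS' hdom hJ hJnn hJpos
    hpair hne hT hC hLinv hB₅ hα hgk hgk1 hC' hεk hδ.le hβ₀ hβ₁ hN hk hδM hMN hε hαeq hεeq hNW hΓ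

end Knit

end

end Literature.MathematicalPhysics.QuantumFieldTheory.Balaban1983to89.B16Ineq147LatticeContours
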